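/-
Copyright (c) 2026 the pub-hodgecm-mathlib formalisation cell (harness21).  Prover seat hodgecm-mathlib-K2E1-p11 (g3), Track B ∕ K2-LIT, h413 = `stmt-HodgeConjecture-24833`,
R90-TF S8 «ContSpec-n½» (S8 dealer R90-CS-plan (g2) S8-R51 (b), 2026-09-04T22:31:08Z, after ★ F3 p862523 and the G-SIDE SEAM RULE «all G-letter payers type on Mok's carrier
`quasiSplit L⁺ L c 3`; the literal form lives only in ★ F3's seam + B's socket lines»): F2 ON THE PRINT CURRENCY — the post-closure classification whose OUTPUT is ★ F3's
hypothesis body token for token.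
-/
import Summits.HodgeConjecture.HodgeConjecture.Theorems.R90S8ResGClassificationOfClosureU3      -- ★ p862459 (R90-C14-p02) F2 §2 `isOneDimensional_or_label_of_le_topologicalClosure_sup` (generic datum)
import Summits.HodgeConjecture.HodgeConjecture.Theorems.R90S8LocalConstituentsInOfEquiv         -- ★ p861540 (K2E1-p15) #9-engine `localConstituentsIn_of_areUnitarilyEquivalent` (generic form `H`)
import Summits.HodgeConjecture.HodgeConjecture.Theorems.R90S8ResGTransportOfQuasiSplitU3       -- ★ p862523 (K2E1-p11) F3 `resG_classification_of_quasiSplit` (+ ★ `IsPiN`, `cmResidualSubspaceR`, `UnitaryGroup.cmConj_antidiagonal_transpose`)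
import HarnessLib

/-!
# S8 #2-road ON THE PRINT CURRENCY — `R90S8ResGClassificationQuasiSplitU3` (F2_qs): an irreducible constituent of `L²(U_{L/L⁺}(3))` on Mok's `quasiSplit L⁺ L c 3` lying in
# `closure ((⨆_ψ ℂ·[ψ̄∘det]) ⊔ (⨆_k Bn k))` is ONE-DIMENSIONAL or has «`π_v = πⁿ(ξ_v)` at every finite `v`» — the output is EXACTLY the hypothesis body of ★ F3 `resG_classification_of_quasiSplit`

Track B ∕ K2-LIT, crux h413 = `stmt-HodgeConjecture-24833`, route of record `HCCMUnconditional`; cell `hodgecm-mathlib`, R90-TF S8; S8 dealer R90-CS-plan (g2) S8-R51 (b) (census K2E1-p11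
2026-09-04T22:30:10Z «a closure-transport cannot move specific Eisenstein-built families across the form seam; run the whole G-chain on the print currency and cross ONCE through ★ F3»,
adopted as S8's G-SIDE SEAM RULE).  THEOREMS ONLY (no `def`, no `instance`, no `notation`, no named-fact hypothesis, no `sorry`; default heartbeats); lane
`--supports stmt-HodgeConjecture-24833 --as helper` (count-neutral).  CLOSES NO SOCKET (#2 ∕ #2♯ stay OPEN modulo the six level letters (D₃)(HEAD₃)(E_blk,₃)(O₃)(N_blk,₃)(L₃) of ★ F1_qs
and the block letter `hBn` = the recommended socket `sock_S8_res_middleResidue_isPiN`, EXTERNAL-class [Rogawski1990 §12.2 (3) p. 173]).  The literal-carrier twin ★ F2 p862459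
(R90-C14-p02) stays valid; this file is its print-currency edition.

THE CHAIN FOR #2 ON THE PRINT CURRENCY (S8-R51): letters (qs-side sockets ∕ ★, E1's Eisenstein estate pays them natively) ⟹ ★ F1_qs `residualG_le_topologicalClosure_of_letters_quasiSplit`
(R90-C133-p03, ★ p862541 §3: `P ≤ closure C`, `C` = THIS FILE's `hle` RHS byte for byte) ⟹ **F2_qs (this file)** ⟹ ★ F3 `resG_classification_of_quasiSplit` (K2E1-p11, p862523) ⟹ #2's
bytes on the literal `Φ₃`.  B ED. 5 (R90-CS-typ2 pen), #2: `exact resG_classification_of_quasiSplit (fun L _ _ _ μ _ 𝔓 _ μω hμu _ P hP => isOneDimensional_or_exists_isPiNqs L μ μω hμu ξ Bn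
hBn P (residualG_le_topologicalClosure_of_letters_quasiSplit L μ 𝔓 P.space P.irreducible hP Iso Blk At Ln Bn hD hHead hEblk hO hN hL))`; #2♯ with `…_and` and
`R ξ := LHalfNeZero (ξ.bcη⁻¹ * μω)` into ★ `resG_classification_sharp_of_quasiSplit`.
* §1 **`isOneDimensional_or_exists_isPiNqs_of_le_topologicalClosure`** (index-keeping) — ★ F2 §2 `isOneDimensional_or_label_of_le_topologicalClosure_sup` (generic datum) at
  `𝒢 := quasiSplit … 3`, lines `ψ ↦ cmDetChar L 3 ((antidiagonal 3).over L) ψ.1 ψ.2 _` (★ F1_qs §3 ∕ ★ F6 lattice bytes), label `Q P k :=` «`π_v = πⁿ((ξ k)_v)` ∀ finite `v`» spelled as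
  ★ `IsPiN`'s body on the print currency (= ★ F3's hypothesis body: `CMLocalAPacket L ((StdForm.antidiagonal 3).over L) v`, witnesses ★ `UnitaryGroup.cmConj_antidiagonal_transpose L 3`
  ∕ ★ `StdForm.isUnit_over`, carrier `(quasiSplit …).Local v`), stability `hQ` by ★ `localConstituentsIn_of_areUnitarilyEquivalent` (generic in the form; `quasiSplit` is an
  `abbrev` of `adelicGroupData`, so NO instance seam — only the clause `LocalConstituentsIn` mentions `P`).
* §2 **`isOneDimensional_or_exists_isPiNqs`** — ★ F3 `resG_classification_of_quasiSplit`'s hypothesis consequent VERBATIM; **`isOneDimensional_or_exists_isPiNqs_and`** — ★ F3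
  `resG_classification_sharp_of_quasiSplit`'s (side predicate `R`, for #2♯ `R ξ = LHalfNeZero (ξ.bcη⁻¹ * μω)`).
* §3 **`res_classification_of_quasiSplit_chain`** — the END-TO-END junction: a print-currency chain (∃ labelled blocks with the block letter + ★ F1_qs's conclusion) for every CM
  field ⟹ socket #2's LITERAL bytes, §2 fed into ★ F3 (kernel check that §2's output IS ★ F3's hypothesis body; B ED. 5's #2 line packaged as one term).
PRINT: [Rogawski1990, §13.9 p. 229 (i)–(ii); §12.2 (3) p. 173]; [MoeglinWaldspurger1995, I.2.18, V.3.13]; [Dixmier1977, §5.4]; the form of [Mok2014, §1 Notation p. 5].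
HONEST LABEL: HC_CM is proved only modulo the 7 printed citations (2 remaining named inputs: hLiu418 = `stmt-HodgeConjecture-24832`, h413 = `stmt-HodgeConjecture-24833`) until rung 0
closes; REL ≠ ★ ≠ BUILT; conditional by construction on its visible binders; closes no socket; count-neutral.
-/

set_option autoImplicit false
set_option linter.dupNamespace false  -- the mandated namespace `…HodgeConjecture.HodgeConjecture.R90.S8` (LEAD #1 L1) repeats the summit's segment

noncomputable section

open MeasureTheory NumberField IsDedekindDomain
open Literature.NumberTheory.GaloisRepresentations Literature.NumberTheory.Automorphic.Arthur2013.Leaves.TECR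
open Literature.NumberTheory.Automorphic Literature.NumberTheory.Automorphic.UnitaryGroup Literature.NumberTheory.Rogawski1990

open Summit.HodgeConjecture.HodgeConjecture.Cruxes.H413.K2E1CuspidalSpectrumUnitary
open Summit.HodgeConjecture.HodgeConjecture.Cruxes.H413.R90S8ResidualDefs (IsPiN)

namespace Summit.HodgeConjecture.HodgeConjecture.R90.S8

open ContRepresentation

variable (L : Type) [Field L] [NumberField L] [IsCMField L]
  (μ : Measure (quasiSplit (↥(maximalRealSubfield L)) L (IsCMField.complexConj L) 3).automorphicQuotient)
  [(quasiSplit (↥(maximalRealSubfield L)) L (IsCMField.complexConj L) 3).IsAutomorphicMeasure μ]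

/-! ## §1 Character lines ⊔ `πⁿ`-blocks ⟹ one-dimensional or «`π_v = πⁿ(ξ_v)` ∀ finite `v`» (index-keeping) -/

variable (μω : HeckeCharacter L) (hμu : μω.IsUnitary)

/-- **F2_qs, index-keeping form.**  Blocks `Bn : κ → ClosedSubrep` on `quasiSplit L⁺ L c 3` labelled by `ξ : κ → OneDimAutRepH L`, block letter `hBn` («every irreducible closed
`P′ ≤ Bn k` has `π_v = πⁿ((ξ k)_v)` at every finite `v`», spelled as ★ `IsPiN`'s body on the print currency — the content of the recommended socket
`sock_S8_res_middleResidue_isPiN`): an irreducible `P ≤ closure ((⨆_ψ ℂ·[ψ̄∘det]) ⊔ (⨆_k Bn k))` is one-dimensional or carries the label of a block it meets — ★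
`isOneDimensional_or_label_of_le_topologicalClosure_sup` at `𝒢 := quasiSplit … 3`, the label transported along unitary equivalence by ★ `localConstituentsIn_of_areUnitarilyEquivalent`
(only the clause `LocalConstituentsIn` mentions `P`). [cite: Rogawski1990, §13.9 p. 229 (i)–(ii)] [cite: Rogawski1990, §12.2 (3) p. 173] [cite: Dixmier1977, §5.4] -/
theorem isOneDimensional_or_exists_isPiNqs_of_le_topologicalClosure {κ : Type*} (ξ : κ → OneDimAutRepH L)
    (Bn : κ → ClosedSubrep ((quasiSplit (↥(maximalRealSubfield L)) L (IsCMField.complexConj L) 3).rightRegular μ))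
    (hBn : ∀ (k : κ) (P' : DiscreteAutomorphicRep (quasiSplit (↥(maximalRealSubfield L)) L (IsCMField.complexConj L) 3) μ), P'.space ≤ Bn k →
      ∃ Pv : ∀ v : HeightOneSpectrum (𝓞 ↥(maximalRealSubfield L)), CMLocalAPacket L ((StdForm.antidiagonal 3).over L) v,
        (ξ k).IsXiLocalFamily (UnitaryGroup.cmConj_antidiagonal_transpose L 3)
            ((Matrix.isUnit_iff_isUnit_det _).mp (StdForm.isUnit_over (StdForm.antidiagonal 3) L)) μω hμu Pv ∧
        LocalConstituentsIn P' Pv ∧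
        ∀ v : HeightOneSpectrum (𝓞 ↥(maximalRealSubfield L)),
          (∀ w : PlacesOver L v, IsCMField.complexConj L • w.1 = w.1) →
          ∀ c : IrrClass ((quasiSplit (↥(maximalRealSubfield L)) L (IsCMField.complexConj L) 3).Local v), c ∈ (Pv v).members →
            ¬ c.IsSupercuspidal ∧
            ∀ [MeasurableSpace ((quasiSplit (↥(maximalRealSubfield L)) L (IsCMField.complexConj L) 3).Local v ⧸
                  Subgroup.center ((quasiSplit (↥(maximalRealSubfield L)) L (IsCMField.complexConj L) 3).Local v))]
              [BorelSpace ((quasiSplit (↥(maximalRealSubfield L)) L (IsCMField.complexConj L) 3).Local v ⧸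
                  Subgroup.center ((quasiSplit (↥(maximalRealSubfield L)) L (IsCMField.complexConj L) 3).Local v))]
              (μZ : Measure ((quasiSplit (↥(maximalRealSubfield L)) L (IsCMField.complexConj L) 3).Local v ⧸
                  Subgroup.center ((quasiSplit (↥(maximalRealSubfield L)) L (IsCMField.complexConj L) 3).Local v)))
              [μZ.IsHaarMeasure], ¬ c.IsSquareIntegrable μZ)
    (P : DiscreteAutomorphicRep (quasiSplit (↥(maximalRealSubfield L)) L (IsCMField.complexConj L) 3) μ)
    (hle : P.space.toSubmodule ≤
      ((⨆ ψ : {ψ : ↥(TorusDict.torus (IsCMField.complexConj L)) →ₜ* ℂˣ // TorusDict.IsAutomorphic (IsCMField.complexConj L) ψ},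
        (AdelicGroupData.AutomorphicCharacter.lineSubrep (𝒢 := (quasiSplit (↥(maximalRealSubfield L)) L (IsCMField.complexConj L) 3))
          (cmDetChar L 3 ((StdForm.antidiagonal 3).over L) ψ.1 ψ.2 ((Matrix.isUnit_iff_isUnit_det _).mp (StdForm.isUnit_over (StdForm.antidiagonal 3) L)).ne_zero) μ).toSubmodule) ⊔
        ⨆ k, (Bn k).toSubmodule).topologicalClosure) :
    P.IsOneDimensional ∨ ∃ k : κ,
      ∃ Pv : ∀ v : HeightOneSpectrum (𝓞 ↥(maximalRealSubfield L)), CMLocalAPacket L ((StdForm.antidiagonal 3).over L) v,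
        (ξ k).IsXiLocalFamily (UnitaryGroup.cmConj_antidiagonal_transpose L 3)
            ((Matrix.isUnit_iff_isUnit_det _).mp (StdForm.isUnit_over (StdForm.antidiagonal 3) L)) μω hμu Pv ∧
        LocalConstituentsIn P Pv ∧
        ∀ v : HeightOneSpectrum (𝓞 ↥(maximalRealSubfield L)),
          (∀ w : PlacesOver L v, IsCMField.complexConj L • w.1 = w.1) →
          ∀ c : IrrClass ((quasiSplit (↥(maximalRealSubfield L)) L (IsCMField.complexConj L) 3).Local v), c ∈ (Pv v).members →
            ¬ c.IsSupercuspidal ∧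
            ∀ [MeasurableSpace ((quasiSplit (↥(maximalRealSubfield L)) L (IsCMField.complexConj L) 3).Local v ⧸
                  Subgroup.center ((quasiSplit (↥(maximalRealSubfield L)) L (IsCMField.complexConj L) 3).Local v))]
              [BorelSpace ((quasiSplit (↥(maximalRealSubfield L)) L (IsCMField.complexConj L) 3).Local v ⧸
                  Subgroup.center ((quasiSplit (↥(maximalRealSubfield L)) L (IsCMField.complexConj L) 3).Local v))]
              (μZ : Measure ((quasiSplit (↥(maximalRealSubfield L)) L (IsCMField.complexConj L) 3).Local v ⧸
                  Subgroup.center ((quasiSplit (↥(maximalRealSubfield L)) L (IsCMField.complexConj L) 3).Local v)))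
              [μZ.IsHaarMeasure], ¬ c.IsSquareIntegrable μZ :=
  isOneDimensional_or_label_of_le_topologicalClosure_sup
    (fun ψ : {ψ : ↥(TorusDict.torus (IsCMField.complexConj L)) →ₜ* ℂˣ // TorusDict.IsAutomorphic (IsCMField.complexConj L) ψ} =>
      cmDetChar L 3 ((StdForm.antidiagonal 3).over L) ψ.1 ψ.2 ((Matrix.isUnit_iff_isUnit_det _).mp (StdForm.isUnit_over (StdForm.antidiagonal 3) L)).ne_zero)
    Bn _ (fun P P' k h hP => by
      obtain ⟨Pv, hξ, hPv, hn⟩ := hP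
      exact ⟨Pv, hξ, localConstituentsIn_of_areUnitarilyEquivalent h hPv, hn⟩) hBn P hle

/-! ## §2 ★ F3's hypothesis consequents verbatim (#2 and #2♯ shapes) -/

/-- **F2_qs, ★ F3's hypothesis consequent VERBATIM** (`P.IsOneDimensional ∨ ∃ ξ : OneDimAutRepH L, «π_v = πⁿ(ξ_v) ∀ finite v» on the print currency`) from the closed-span statement and
the block letter. [cite: Rogawski1990, §13.9 p. 229 (i)–(ii)] -/
theorem isOneDimensional_or_exists_isPiNqs {κ : Type*} (ξ : κ → OneDimAutRepH L)
    (Bn : κ → ClosedSubrep ((quasiSplit (↥(maximalRealSubfield L)) L (IsCMField.complexConj L) 3).rightRegular μ))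
    (hBn : ∀ (k : κ) (P' : DiscreteAutomorphicRep (quasiSplit (↥(maximalRealSubfield L)) L (IsCMField.complexConj L) 3) μ), P'.space ≤ Bn k →
      ∃ Pv : ∀ v : HeightOneSpectrum (𝓞 ↥(maximalRealSubfield L)), CMLocalAPacket L ((StdForm.antidiagonal 3).over L) v,
        (ξ k).IsXiLocalFamily (UnitaryGroup.cmConj_antidiagonal_transpose L 3)
            ((Matrix.isUnit_iff_isUnit_det _).mp (StdForm.isUnit_over (StdForm.antidiagonal 3) L)) μω hμu Pv ∧
        LocalConstituentsIn P' Pv ∧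
        ∀ v : HeightOneSpectrum (𝓞 ↥(maximalRealSubfield L)),
          (∀ w : PlacesOver L v, IsCMField.complexConj L • w.1 = w.1) →
          ∀ c : IrrClass ((quasiSplit (↥(maximalRealSubfield L)) L (IsCMField.complexConj L) 3).Local v), c ∈ (Pv v).members →
            ¬ c.IsSupercuspidal ∧
            ∀ [MeasurableSpace ((quasiSplit (↥(maximalRealSubfield L)) L (IsCMField.complexConj L) 3).Local v ⧸
                  Subgroup.center ((quasiSplit (↥(maximalRealSubfield L)) L (IsCMField.complexConj L) 3).Local v))]
              [BorelSpace ((quasiSplit (↥(maximalRealSubfield L)) L (IsCMField.complexConj L) 3).Local v ⧸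
                  Subgroup.center ((quasiSplit (↥(maximalRealSubfield L)) L (IsCMField.complexConj L) 3).Local v))]
              (μZ : Measure ((quasiSplit (↥(maximalRealSubfield L)) L (IsCMField.complexConj L) 3).Local v ⧸
                  Subgroup.center ((quasiSplit (↥(maximalRealSubfield L)) L (IsCMField.complexConj L) 3).Local v)))
              [μZ.IsHaarMeasure], ¬ c.IsSquareIntegrable μZ)
    (P : DiscreteAutomorphicRep (quasiSplit (↥(maximalRealSubfield L)) L (IsCMField.complexConj L) 3) μ)
    (hle : P.space.toSubmodule ≤
      ((⨆ ψ : {ψ : ↥(TorusDict.torus (IsCMField.complexConj L)) →ₜ* ℂˣ // TorusDict.IsAutomorphic (IsCMField.complexConj L) ψ},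
        (AdelicGroupData.AutomorphicCharacter.lineSubrep (𝒢 := (quasiSplit (↥(maximalRealSubfield L)) L (IsCMField.complexConj L) 3))
          (cmDetChar L 3 ((StdForm.antidiagonal 3).over L) ψ.1 ψ.2 ((Matrix.isUnit_iff_isUnit_det _).mp (StdForm.isUnit_over (StdForm.antidiagonal 3) L)).ne_zero) μ).toSubmodule) ⊔
        ⨆ k, (Bn k).toSubmodule).topologicalClosure) :
    P.IsOneDimensional ∨ ∃ ξ' : OneDimAutRepH L,
      ∃ Pv : ∀ v : HeightOneSpectrum (𝓞 ↥(maximalRealSubfield L)), CMLocalAPacket L ((StdForm.antidiagonal 3).over L) v,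
        ξ'.IsXiLocalFamily (UnitaryGroup.cmConj_antidiagonal_transpose L 3)
            ((Matrix.isUnit_iff_isUnit_det _).mp (StdForm.isUnit_over (StdForm.antidiagonal 3) L)) μω hμu Pv ∧
        LocalConstituentsIn P Pv ∧
        ∀ v : HeightOneSpectrum (𝓞 ↥(maximalRealSubfield L)),
          (∀ w : PlacesOver L v, IsCMField.complexConj L • w.1 = w.1) →
          ∀ c : IrrClass ((quasiSplit (↥(maximalRealSubfield L)) L (IsCMField.complexConj L) 3).Local v), c ∈ (Pv v).members →
            ¬ c.IsSupercuspidal ∧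
            ∀ [MeasurableSpace ((quasiSplit (↥(maximalRealSubfield L)) L (IsCMField.complexConj L) 3).Local v ⧸
                  Subgroup.center ((quasiSplit (↥(maximalRealSubfield L)) L (IsCMField.complexConj L) 3).Local v))]
              [BorelSpace ((quasiSplit (↥(maximalRealSubfield L)) L (IsCMField.complexConj L) 3).Local v ⧸
                  Subgroup.center ((quasiSplit (↥(maximalRealSubfield L)) L (IsCMField.complexConj L) 3).Local v))]
              (μZ : Measure ((quasiSplit (↥(maximalRealSubfield L)) L (IsCMField.complexConj L) 3).Local v ⧸
                  Subgroup.center ((quasiSplit (↥(maximalRealSubfield L)) L (IsCMField.complexConj L) 3).Local v)))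
              [μZ.IsHaarMeasure], ¬ c.IsSquareIntegrable μZ :=
  (isOneDimensional_or_exists_isPiNqs_of_le_topologicalClosure L μ μω hμu ξ Bn hBn P hle).imp_right fun ⟨k, hk⟩ => ⟨ξ k, hk⟩

/-- **F2_qs, socket #2♯'s consequent SHAPE**: blocks indexed by the `ξ` satisfying a side predicate `R` (for #2♯: `R ξ = LHalfNeZero (ξ.bcη⁻¹ * μω)`) ⟹ `P.IsOneDimensional ∨ ∃ ξ, «…» ∧ R ξ`
(★ F3 `resG_classification_sharp_of_quasiSplit`'s hypothesis consequent). [cite: Rogawski1990, §13.9 p. 229 (ii)] -/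
theorem isOneDimensional_or_exists_isPiNqs_and (R : OneDimAutRepH L → Prop)
    (Bn : {ξ : OneDimAutRepH L // R ξ} → ClosedSubrep ((quasiSplit (↥(maximalRealSubfield L)) L (IsCMField.complexConj L) 3).rightRegular μ))
    (hBn : ∀ (k : {ξ : OneDimAutRepH L // R ξ}) (P' : DiscreteAutomorphicRep (quasiSplit (↥(maximalRealSubfield L)) L (IsCMField.complexConj L) 3) μ), P'.space ≤ Bn k →
      ∃ Pv : ∀ v : HeightOneSpectrum (𝓞 ↥(maximalRealSubfield L)), CMLocalAPacket L ((StdForm.antidiagonal 3).over L) v,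
        k.1.IsXiLocalFamily (UnitaryGroup.cmConj_antidiagonal_transpose L 3)
            ((Matrix.isUnit_iff_isUnit_det _).mp (StdForm.isUnit_over (StdForm.antidiagonal 3) L)) μω hμu Pv ∧
        LocalConstituentsIn P' Pv ∧
        ∀ v : HeightOneSpectrum (𝓞 ↥(maximalRealSubfield L)),
          (∀ w : PlacesOver L v, IsCMField.complexConj L • w.1 = w.1) →
          ∀ c : IrrClass ((quasiSplit (↥(maximalRealSubfield L)) L (IsCMField.complexConj L) 3).Local v), c ∈ (Pv v).members →
            ¬ c.IsSupercuspidal ∧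
            ∀ [MeasurableSpace ((quasiSplit (↥(maximalRealSubfield L)) L (IsCMField.complexConj L) 3).Local v ⧸
                  Subgroup.center ((quasiSplit (↥(maximalRealSubfield L)) L (IsCMField.complexConj L) 3).Local v))]
              [BorelSpace ((quasiSplit (↥(maximalRealSubfield L)) L (IsCMField.complexConj L) 3).Local v ⧸
                  Subgroup.center ((quasiSplit (↥(maximalRealSubfield L)) L (IsCMField.complexConj L) 3).Local v))]
              (μZ : Measure ((quasiSplit (↥(maximalRealSubfield L)) L (IsCMField.complexConj L) 3).Local v ⧸
                  Subgroup.center ((quasiSplit (↥(maximalRealSubfield L)) L (IsCMField.complexConj L) 3).Local v)))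
              [μZ.IsHaarMeasure], ¬ c.IsSquareIntegrable μZ)
    (P : DiscreteAutomorphicRep (quasiSplit (↥(maximalRealSubfield L)) L (IsCMField.complexConj L) 3) μ)
    (hle : P.space.toSubmodule ≤
      ((⨆ ψ : {ψ : ↥(TorusDict.torus (IsCMField.complexConj L)) →ₜ* ℂˣ // TorusDict.IsAutomorphic (IsCMField.complexConj L) ψ},
        (AdelicGroupData.AutomorphicCharacter.lineSubrep (𝒢 := (quasiSplit (↥(maximalRealSubfield L)) L (IsCMField.complexConj L) 3))
          (cmDetChar L 3 ((StdForm.antidiagonal 3).over L) ψ.1 ψ.2 ((Matrix.isUnit_iff_isUnit_det _).mp (StdForm.isUnit_over (StdForm.antidiagonal 3) L)).ne_zero) μ).toSubmodule) ⊔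
        ⨆ k, (Bn k).toSubmodule).topologicalClosure) :
    P.IsOneDimensional ∨ ∃ ξ : OneDimAutRepH L,
      (∃ Pv : ∀ v : HeightOneSpectrum (𝓞 ↥(maximalRealSubfield L)), CMLocalAPacket L ((StdForm.antidiagonal 3).over L) v,
        ξ.IsXiLocalFamily (UnitaryGroup.cmConj_antidiagonal_transpose L 3)
            ((Matrix.isUnit_iff_isUnit_det _).mp (StdForm.isUnit_over (StdForm.antidiagonal 3) L)) μω hμu Pv ∧
        LocalConstituentsIn P Pv ∧
        ∀ v : HeightOneSpectrum (𝓞 ↥(maximalRealSubfield L)),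
          (∀ w : PlacesOver L v, IsCMField.complexConj L • w.1 = w.1) →
          ∀ c : IrrClass ((quasiSplit (↥(maximalRealSubfield L)) L (IsCMField.complexConj L) 3).Local v), c ∈ (Pv v).members →
            ¬ c.IsSupercuspidal ∧
            ∀ [MeasurableSpace ((quasiSplit (↥(maximalRealSubfield L)) L (IsCMField.complexConj L) 3).Local v ⧸
                  Subgroup.center ((quasiSplit (↥(maximalRealSubfield L)) L (IsCMField.complexConj L) 3).Local v))]
              [BorelSpace ((quasiSplit (↥(maximalRealSubfield L)) L (IsCMField.complexConj L) 3).Local v ⧸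
                  Subgroup.center ((quasiSplit (↥(maximalRealSubfield L)) L (IsCMField.complexConj L) 3).Local v))]
              (μZ : Measure ((quasiSplit (↥(maximalRealSubfield L)) L (IsCMField.complexConj L) 3).Local v ⧸
                  Subgroup.center ((quasiSplit (↥(maximalRealSubfield L)) L (IsCMField.complexConj L) 3).Local v)))
              [μZ.IsHaarMeasure], ¬ c.IsSquareIntegrable μZ) ∧
      R ξ :=
  (isOneDimensional_or_exists_isPiNqs_of_le_topologicalClosure L μ μω hμu (fun k : {ξ : OneDimAutRepH L // R ξ} => k.1) Bn hBn P hle).imp_right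
    fun ⟨k, hk⟩ => ⟨k.1, hk, k.2⟩

/-! ## §3 The composition through ★ F3 — socket #2's LITERAL bytes from a print-currency chain (kernel check that §2's output IS ★ F3's hypothesis body) -/

/-- **END-TO-END JUNCTION (#2)**: if on Mok's carrier, for every CM field, automorphic measure, Heisenberg parabolic datum and residual irreducible `P`, some labelled block family
`(ξ, Bn)` satisfies the block letter and `P ≤ closure ((⨆_ψ ℂ·[ψ̄∘det]) ⊔ (⨆_k Bn k))` (★ F1_qs's conclusion shape), then socket #2's EXACT bytes on the literal `Φ₃` hold — §2 fed into ★ F3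
`resG_classification_of_quasiSplit`.  This is B ED. 5's #2 line packaged as one term; it closes nothing by itself (its hypothesis is the whole qs-side chain). [cite: Rogawski1990, §13.9 p. 229 (i)–(ii)] -/
theorem res_classification_of_quasiSplit_chain
    (Hqs : ∀ (L : Type) [Field L] [NumberField L] [IsCMField L]
      (μ : Measure (quasiSplit (↥(maximalRealSubfield L)) L (IsCMField.complexConj L) 3).automorphicQuotient)
      [(quasiSplit (↥(maximalRealSubfield L)) L (IsCMField.complexConj L) 3).IsAutomorphicMeasure μ]
      (𝔓 : (quasiSplit (↥(maximalRealSubfield L)) L (IsCMField.complexConj L) 3).ParabolicUnipotentData)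
      (_ : ∀ j : 𝔓.ι, 𝔓.radical j = adelicUnipotent (↥(maximalRealSubfield L)) L (IsCMField.complexConj L) 3)
      (μω : HeckeCharacter L) (hμu : μω.IsUnitary),
      (∀ x : Literature.NumberTheory.GaloisRepresentations.ideleGroup ↥(maximalRealSubfield L),
        μω (AdeleRing.ideleBaseChange (↥(maximalRealSubfield L)) L x) = quadraticHeckeCharCM L x) →
      ∀ (P : DiscreteAutomorphicRep (quasiSplit (↥(maximalRealSubfield L)) L (IsCMField.complexConj L) 3) μ),
        P.space ≤ residualSubspace (quasiSplit (↥(maximalRealSubfield L)) L (IsCMField.complexConj L) 3) μ 𝔓 →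
        ∃ (κ : Type) (ξ : κ → OneDimAutRepH L) (Bn : κ → ClosedSubrep ((quasiSplit (↥(maximalRealSubfield L)) L (IsCMField.complexConj L) 3).rightRegular μ)),
          (∀ (k : κ) (P' : DiscreteAutomorphicRep (quasiSplit (↥(maximalRealSubfield L)) L (IsCMField.complexConj L) 3) μ), P'.space ≤ Bn k →
            ∃ Pv : ∀ v : HeightOneSpectrum (𝓞 ↥(maximalRealSubfield L)), CMLocalAPacket L ((StdForm.antidiagonal 3).over L) v,
              (ξ k).IsXiLocalFamily (UnitaryGroup.cmConj_antidiagonal_transpose L 3)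
                  ((Matrix.isUnit_iff_isUnit_det _).mp (StdForm.isUnit_over (StdForm.antidiagonal 3) L)) μω hμu Pv ∧
              LocalConstituentsIn P' Pv ∧
              ∀ v : HeightOneSpectrum (𝓞 ↥(maximalRealSubfield L)),
                (∀ w : PlacesOver L v, IsCMField.complexConj L • w.1 = w.1) →
                ∀ c : IrrClass ((quasiSplit (↥(maximalRealSubfield L)) L (IsCMField.complexConj L) 3).Local v), c ∈ (Pv v).members →
                  ¬ c.IsSupercuspidal ∧
                  ∀ [MeasurableSpace ((quasiSplit (↥(maximalRealSubfield L)) L (IsCMField.complexConj L) 3).Local v ⧸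
                        Subgroup.center ((quasiSplit (↥(maximalRealSubfield L)) L (IsCMField.complexConj L) 3).Local v))]
                    [BorelSpace ((quasiSplit (↥(maximalRealSubfield L)) L (IsCMField.complexConj L) 3).Local v ⧸
                        Subgroup.center ((quasiSplit (↥(maximalRealSubfield L)) L (IsCMField.complexConj L) 3).Local v))]
                    (μZ : Measure ((quasiSplit (↥(maximalRealSubfield L)) L (IsCMField.complexConj L) 3).Local v ⧸
                        Subgroup.center ((quasiSplit (↥(maximalRealSubfield L)) L (IsCMField.complexConj L) 3).Local v)))
                    [μZ.IsHaarMeasure], ¬ c.IsSquareIntegrable μZ) ∧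
          P.space.toSubmodule ≤
            ((⨆ ψ : {ψ : ↥(TorusDict.torus (IsCMField.complexConj L)) →ₜ* ℂˣ // TorusDict.IsAutomorphic (IsCMField.complexConj L) ψ},
              (AdelicGroupData.AutomorphicCharacter.lineSubrep (𝒢 := (quasiSplit (↥(maximalRealSubfield L)) L (IsCMField.complexConj L) 3))
                (cmDetChar L 3 ((StdForm.antidiagonal 3).over L) ψ.1 ψ.2 ((Matrix.isUnit_iff_isUnit_det _).mp (StdForm.isUnit_over (StdForm.antidiagonal 3) L)).ne_zero) μ).toSubmodule) ⊔
              ⨆ k, (Bn k).toSubmodule).topologicalClosure) :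
    ∀ (L : Type) [Field L] [NumberField L] [IsCMField L]
      (μ : Measure (UnitaryGroup.cmDatum L 3 (qsForm L)).automorphicQuotient) [(UnitaryGroup.cmDatum L 3 (qsForm L)).IsAutomorphicMeasure μ]
      (μω : HeckeCharacter L) (hμu : μω.IsUnitary),
      (∀ x : Literature.NumberTheory.GaloisRepresentations.ideleGroup ↥(maximalRealSubfield L),
        μω (AdeleRing.ideleBaseChange (↥(maximalRealSubfield L)) L x) = quadraticHeckeCharCM L x) →
      ∀ (P : DiscreteAutomorphicRep (UnitaryGroup.cmDatum L 3 (qsForm L)) μ),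
        P.space ≤ cmResidualSubspaceR L 3 μ →
        P.IsOneDimensional ∨ ∃ ξ : OneDimAutRepH L, IsPiN P μω hμu ξ :=
  resG_classification_of_quasiSplit fun L _ _ _ μ _ 𝔓 h𝔓 μω hμu hμω P hP => by
    obtain ⟨κ, ξ, Bn, hBn, hle⟩ := Hqs L μ 𝔓 h𝔓 μω hμu hμω P hP
    exact isOneDimensional_or_exists_isPiNqs L μ μω hμu ξ Bn hBn P hle

end Summit.HodgeConjecture.HodgeConjecture.R90.S8

end
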